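import Summits.HodgeConjecture.HodgeConjecture.Theorems.Ring2HypothesesDescentMotivatedCupProduct
import HarnessLib

/-!
# Ring 2 hypotheses, descent face — Lefschetz components lie in the one-star sandwich span;
# the Lefschetz components of an ALGEBRAIC class are MOTIVATED (unconditionally)

research route conditional on HC_CM; not a corollary; Q11.4-sentence-2 already refuted in dim ≥ 3.
Cell `pub-hodge-ring2` (Hodge ladder STAGE 3), seat `ring2-b05` (binder row b05
`Ring2.Hypotheses.MotivatedImpliesAlgebraicAV`), gen 35. `HC_CM` (`Theses.RankFourFaces.CMAbelianHodge`) does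
not occur in this file; nothing here proves a case of the Hodge conjecture; the row b05 stays OPEN.

The one-variable case of the elimination behind André's Lemme 1.3.2 (`mono_mem_starSpan`,
`Theorems/Ring2HypothesesDescentMotivatedBoxStar`), where everything is explicit: for `X` smooth projective of
dimension `n`, `η ∈ H²(X(ℂ); ℂ)` with the hard Lefschetz property, André's sign-free involution `*_η`
(`HodgeTheory.lefschetzInvolution`) and a class `x = Σₖ Lᵏ pₖ ∈ Hʲ(X(ℂ); ℂ)` (Lefschetz decomposition, `pₖ`
primitive): with `c` the exponent sending the component `k` to the top of its string, `Lᶜ x` kills the components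
`k' < k`, and `*_η (Lᶜ x) = pₖ + Σ_{k' > k} L^{k'-k} p_{k'}` (`*_η (Lʲ p) = Lˢ p`, `i + j + s = n`,
`lefschetzInvolution_lefschetzPowTo_eq`); a descending induction over `k` follows.

* §1 `lefschetzComponent_mem_sandwichSpan` — **every Lefschetz component `Lᵃ' pₖ` of `x` lies in the `ℂ`-span of
  the one-star sandwiches `Lᵃ *_η Lᶜ x`** (André 1996 Prop. 2.2 Cor. 2 mechanism: «`A_mot(X)` est stable sous `*`
  … on a la décomposition de Lefschetz `A_mot^j(X)_E = ⊕ Lᵏ P_mot^{j-2k}(X)_E`», p. 16; Kleiman 1968 1.4.4);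
* §2 `lefschetzPowTo_primitivePart_mem_motivatedClasses_of_mem_algebraicClasses` — **for a polarisation class `η`
  and an ALGEBRAIC class `x ∈ Nᵇ H²ᵇ(X(ℂ); ℂ)`, all the classes `Lᵃ' ξ_{(2q,k)}(x)` — in particular the primitive
  components `ξ_{(2q,k)}(x)` of `x` — are MOTIVATED** (`HodgeTheory.motivatedClasses`), unconditionally: the
  sandwiches `Lᵃ *_η Lᶜ x` are André's point generators (`lefschetzInvolution_mem_motivatedClasses`); classically
  this is a consequence of `B(X)` (Kleiman 1968 §1.4, primitive components of algebraic classes are algebraic);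
* §3 `lefschetzPowTo_primitivePart_mem_motivatedClasses_of_star` — the same for a MOTIVATED `x`, GRANTED the
  `*_η`-stability of `A_mot(X)_ℂ` (André Prop. 2.2, not proved in the tree): Cor. 2 of Prop. 2.2 on the real carriers.

No definition, no named fact, no sorry. References: Andre1996Motifs (§1.1 p. 10, Prop. 2.2 and Cor. 1–2 p. 16),
Kleiman1968AlgebraicCycles (§1.4, 1.4.1–1.4.4), VoisinHodgeI2002 (§6.2.3 Cor. 6.26).
-/

noncomputable section

-- every declaration of this problem lives in `Summit.HodgeConjecture.HodgeConjecture.…` (summit = sub-problem)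
set_option linter.dupNamespace false

open CategoryTheory AlgebraicGeometry MonoidalCategory CartesianMonoidalCategory
open Literature.AlgebraicTopology.SingularHomology Literature.Geometry.Kaehler
open Literature.AlgebraicGeometry Literature.AlgebraicGeometry.Motives
  Literature.AlgebraicGeometry.HodgeTheory

namespace Summit.HodgeConjecture.HodgeConjecture.Theorems

variable {n : ℕ} {X : SchemeOver ℂ} {η : complexBetti X 2}

/-! ## §1 Lefschetz components lie in the one-star sandwich span -/

/-- **Lefschetz components lie in the span of the one-star sandwiches.** Let `η ∈ H²(X(ℂ); ℂ)` have the hard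
Lefschetz property in dimension `n` and let `x = Σ_{(i,k) ∈ s} Lᵏ p_{(i,k)} ∈ Hʲ(X(ℂ); ℂ)` be a Lefschetz
decomposition (finite sum over live indices `i + k ≤ n`, `p_{(i,k)} ∈ Pⁱ` primitive, `i + 2k = j`; e.g.
`exists_sum_lefschetzPowTo_eq`). Then for every `(i, k) ∈ s` and every `a'`, the class `Lᵃ' p_{(i,k)}` lies in the
`ℂ`-span of the classes `Lᵃ *_η Lᶜ x`. Descending induction over `k`: with `i + k + c = n`, `Lᶜ x` kills the
components `k' < k` (past the tops of their strings) and `*_η (Lᶜ x) = p_{(i,k)} + Σ_{k'>k} L^{k'-k} p_{k'}`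
(`lefschetzInvolution_lefschetzPowTo_eq`). [cite: Andre1996Motifs, §1.1 (p. 10) and Prop. 2.2 Cor. 2 (p. 16)]
[cite: Kleiman1968AlgebraicCycles, §1.4 (1.4.1–1.4.4)] -/
theorem lefschetzComponent_mem_sandwichSpan (hη : HasHardLefschetzProperty η n) {j : ℕ} {x : complexBetti X j}
    (s : Finset {ik : ℕ × ℕ // ik.1 + 2 * ik.2 = j})
    (p : (ik : {ik : ℕ × ℕ // ik.1 + 2 * ik.2 = j}) → complexBetti X ik.1.1)
    (hp : ∀ ik, p ik ∈ primitiveClasses η n ik.1.1) (hs : ∀ ik ∈ s, ik.1.1 + ik.1.2 ≤ n)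
    (hx : x = ∑ ik ∈ s, lefschetzPowTo η ik.1.2 ik.1.1 j ik.2 (p ik))
    {ik : {ik : ℕ × ℕ // ik.1 + 2 * ik.2 = j}} (hik : ik ∈ s) (a' : ℕ) {T : ℕ} (hT : ik.1.1 + 2 * a' = T) :
    lefschetzPowTo η a' ik.1.1 T hT (p ik) ∈
      Submodule.span ℂ {z : complexBetti X T | ∃ (a c M M' : ℕ) (hc : j + 2 * c = M) (hMM' : M + M' = 2 * n)
        (ha : M' + 2 * a = T),
        z = lefschetzPowTo η a M' T ha (lefschetzInvolution hη hMM' (lefschetzPowTo η c j M hc x))} := by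
  classical
  -- descending induction over `k`, measured by `e` with `k + e = j`
  suffices key : ∀ (e : ℕ) (ik : {ik : ℕ × ℕ // ik.1 + 2 * ik.2 = j}), ik ∈ s → ik.1.2 + e = j →
      ∀ (a' T : ℕ) (hT : ik.1.1 + 2 * a' = T), lefschetzPowTo η a' ik.1.1 T hT (p ik) ∈
        Submodule.span ℂ {z : complexBetti X T | ∃ (a c M M' : ℕ) (hc : j + 2 * c = M) (hMM' : M + M' = 2 * n)
          (ha : M' + 2 * a = T),
          z = lefschetzPowTo η a M' T ha (lefschetzInvolution hη hMM' (lefschetzPowTo η c j M hc x))} by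
    have h1 := ik.2
    exact key (j - ik.1.2) ik hik (by omega) a' T hT
  intro e
  refine Nat.strong_induction_on e fun e IH ↦ ?_
  intro ik hik he a' T hT
  have eik := ik.2
  -- the exponent `c` sending the component `ik` to the top of its string
  obtain ⟨c, hc⟩ : ∃ c, ik.1.1 + ik.1.2 + c = n := ⟨n - (ik.1.1 + ik.1.2), by have := hs ik hik; omega⟩
  set M := j + 2 * c with hMdef
  have hMM' : M + ik.1.1 = 2 * n := by omega
  -- the sandwich `Lᵃ' *_η Lᶜ x` lies in the span
  have hgen : lefschetzPowTo η a' ik.1.1 T hT (lefschetzInvolution hη hMM' (lefschetzPowTo η c j M rfl x)) ∈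
      Submodule.span ℂ {z : complexBetti X T | ∃ (a c M M' : ℕ) (hc : j + 2 * c = M) (hMM' : M + M' = 2 * n)
          (ha : M' + 2 * a = T),
          z = lefschetzPowTo η a M' T ha (lefschetzInvolution hη hMM' (lefschetzPowTo η c j M hc x))} :=
    Submodule.subset_span ⟨a', c, M, _, rfl, hMM', hT, rfl⟩
  -- expand `Lᶜ x` along the decomposition and isolate the component `ik`
  have hLx : lefschetzPowTo η c j M rfl x =
      ∑ ik' ∈ s, lefschetzPowTo η (ik'.1.2 + c) ik'.1.1 M (by have := ik'.2; omega) (p ik') := by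
    rw [hx, map_sum]
    refine Finset.sum_congr rfl fun ik' _ ↦ ?_
    exact lefschetzPowTo_comp_apply η rfl ik'.2 rfl _ _
  rw [hLx, ← Finset.add_sum_erase _ _ hik, map_add, map_add, map_sum, map_sum,
    lefschetzInvolution_lefschetzPowTo_eq hη (show ik.1.1 + (ik.1.2 + c) + 0 = n by omega) _ hMM'
      (show ik.1.1 + 2 * 0 = ik.1.1 by omega) (p ik), lefschetzPowTo_zero_eq_id, LinearMap.id_apply] at hgen
  -- the remaining terms lie in the span, by induction
  have hrest : ∑ ik' ∈ s.erase ik, lefschetzPowTo η a' ik.1.1 T hT (lefschetzInvolution hη hMM'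
      (lefschetzPowTo η (ik'.1.2 + c) ik'.1.1 M (by have := ik'.2; omega) (p ik'))) ∈
      Submodule.span ℂ {z : complexBetti X T | ∃ (a c M M' : ℕ) (hc : j + 2 * c = M) (hMM' : M + M' = 2 * n)
          (ha : M' + 2 * a = T),
          z = lefschetzPowTo η a M' T ha (lefschetzInvolution hη hMM' (lefschetzPowTo η c j M hc x))} := by
    refine Submodule.sum_mem _ fun ik' hik' ↦ ?_
    obtain ⟨hne, hik's⟩ := Finset.mem_erase.1 hik'
    have e1 := ik'.2
    -- the components `k' < k` die past the tops of their strings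
    by_cases hlt : ik'.1.2 < ik.1.2
    · rw [lefschetzPowTo_eq_zero_of_mem_primitiveClasses (hp ik') _ (by omega), map_zero, map_zero]
      exact zero_mem _
    -- the others are higher components: explicit `*_η`, then induction
    have hgt : ik.1.2 < ik'.1.2 := by
      by_contra hle
      apply hne
      have hk : ik'.1.2 = ik.1.2 := by omega
      have hi : ik'.1.1 = ik.1.1 := by omega
      exact Subtype.ext (Prod.ext hi hk)
    obtain ⟨s', hs'⟩ : ∃ s', ik'.1.1 + (ik'.1.2 + c) + s' = n := ⟨ik'.1.2 - ik.1.2, by omega⟩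
    rw [lefschetzInvolution_lefschetzPowTo_eq hη hs' _ hMM' (show ik'.1.1 + 2 * s' = ik.1.1 by omega),
      lefschetzPowTo_comp_apply η rfl _ hT (show ik'.1.1 + 2 * (s' + a') = T by omega)]
    exact IH (j - ik'.1.2) (by omega) ik' hik's (by omega) (s' + a') T _
  have hfinal := Submodule.sub_mem _ hgen hrest
  rwa [add_sub_cancel_right] at hfinal

/-! ## §2 The Lefschetz components of an algebraic class are motivated -/

/-- **One-star sandwiches of an algebraic class are motivated**: for a polarisation class `η` of the smooth
projective `n`-fold `X` and `x ∈ Nᵇ H²ᵇ(X(ℂ); ℂ)`, every `Lᵃ *_η Lᶜ x` (of even degree `2r`) lies in `A_motʳ(X)_ℂ`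
(`Lᶜ x` is algebraic, `*_η` of it is one of André's point generators, `Lᵃ` preserves motivated classes).
[cite: Andre1996Motifs, §2.1 Déf. 1 and remark (p. 14)] -/
theorem sandwich_mem_motivatedClasses_of_mem_algebraicClasses (hX : IsSmoothProjective n X)
    (hη : IsPolarizationClass n X η) {b : ℕ} {x : complexBetti X (2 * b)} (hx : x ∈ algebraicClasses X b)
    (a c M M' : ℕ) {r : ℕ} (hc : 2 * b + 2 * c = M) (hMM' : M + M' = 2 * n) (ha : M' + 2 * a = 2 * r) :
    lefschetzPowTo η a M' (2 * r) ha (lefschetzInvolution hη.hasHardLefschetz hMM' (lefschetzPowTo η c (2 * b) M hc x)) ∈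
      motivatedClasses n X r := by
  obtain rfl : M = 2 * (b + c) := by omega
  obtain ⟨e, he⟩ : ∃ e, b + c + e = n := ⟨n - (b + c), by omega⟩
  obtain rfl : M' = 2 * e := by omega
  obtain rfl : r = e + a := by omega
  have h1 := lefschetzPowTo_mem_algebraicClasses_of_cupProduct Voisin2003_cupProduct_algebraicClasses_holds hX
    hη.mem_algebraicClasses c b hc hx
  have h2 := lefschetzInvolution_mem_motivatedClasses hX hη he hMM' h1
  exact Ring2.Hypotheses.lefschetzPowTo_mem_motivatedClasses_of_mem hX hη.mem_algebraicClasses a e ha h2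

/-- **The Lefschetz components of an algebraic class are motivated** (unconditionally). For `X` smooth
projective of dimension `n`, a polarisation class `η`, an ALGEBRAIC class `x ∈ Nᵇ H²ᵇ(X(ℂ); ℂ)` and a Lefschetz
index `(2q, k)` (`2q + 2k = 2b`), the classes `Lᵃ' ξ_{(2q,k)}(x) ∈ H^{2(q+a')}(X(ℂ); ℂ)` built from the primitive
part `ξ_{(2q,k)}(x) ∈ P^{2q}` of `x` (`HodgeTheory.primitivePart`; `a' = 0`: the primitive components themselves)
are MOTIVATED: they lie in the span of the sandwiches `Lᵃ *_η Lᶜ x` (`lefschetzComponent_mem_sandwichSpan`),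
which are motivated (`sandwich_mem_motivatedClasses_of_mem_algebraicClasses`). Classically a consequence of
`B(X)` (then they are algebraic, Kleiman 1968 §1.4); André: Prop. 2.2 Cor. 2 with `A(X) ⊆ A_mot(X)`.
[cite: Andre1996Motifs, Prop. 2.2 Cor. 2 (p. 16)] [cite: Kleiman1968AlgebraicCycles, §1.4] -/
theorem lefschetzPowTo_primitivePart_mem_motivatedClasses_of_mem_algebraicClasses (hX : IsSmoothProjective n X)
    (hη : IsPolarizationClass n X η) {b : ℕ} {x : complexBetti X (2 * b)} (hx : x ∈ algebraicClasses X b)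
    (q k : ℕ) (hqk : 2 * q + 2 * k = 2 * b) (a' : ℕ) {r : ℕ} (hr : 2 * q + 2 * a' = 2 * r) :
    lefschetzPowTo η a' (2 * q) (2 * r) hr
        (primitivePart η n hη.hasHardLefschetz (fun _ hm ↦ subsingleton_complexBetti hX hm) ⟨(2 * q, k), hqk⟩ x) ∈
      motivatedClasses n X r := by
  classical
  have hvan : ∀ m, 2 * n < m → Subsingleton (complexBetti X m) := fun m hm ↦ subsingleton_complexBetti hX hm
  -- non-live indices have zero primitive part
  by_cases hlive : n < 2 * q + k
  · rw [primitivePart_of_lt hη.hasHardLefschetz hvan ⟨(2 * q, k), hqk⟩ hlive, LinearMap.zero_apply, map_zero]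
    exact Submodule.zero_mem _
  -- the Lefschetz decomposition of `x` by primitive parts, over live indices
  have hmem : (⟨(2 * q, k), hqk⟩ : {ik : ℕ × ℕ // ik.1 + 2 * ik.2 = 2 * b}) ∈
      Finset.univ.filter (fun ik : {ik : ℕ × ℕ // ik.1 + 2 * ik.2 = 2 * b} ↦ ik.1.1 + ik.1.2 ≤ n) :=
    Finset.mem_filter.2 ⟨Finset.mem_univ _, by simpa using not_lt.1 hlive⟩
  have hdec : x = ∑ ik ∈ Finset.univ.filter (fun ik : {ik : ℕ × ℕ // ik.1 + 2 * ik.2 = 2 * b} ↦ ik.1.1 + ik.1.2 ≤ n),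
      lefschetzPowTo η ik.1.2 ik.1.1 (2 * b) ik.2 (primitivePart η n hη.hasHardLefschetz hvan ik x) := by
    rw [Finset.sum_filter]
    conv_lhs => rw [← sum_lefschetzPowTo_primitivePart hη.hasHardLefschetz hvan x]
    refine Finset.sum_congr rfl fun ik _ ↦ ?_
    split_ifs with h
    · rfl
    · rw [primitivePart_of_lt hη.hasHardLefschetz hvan ik (not_le.1 h), LinearMap.zero_apply, map_zero]
  have hspan := lefschetzComponent_mem_sandwichSpan hη.hasHardLefschetz _ _
    (fun ik ↦ primitivePart_mem hη.hasHardLefschetz hvan ik x) (fun ik hik ↦ (Finset.mem_filter.1 hik).2) hdec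
    hmem a' hr
  refine (Submodule.span_le.2 ?_) hspan
  rintro z ⟨a, c, M, M', hc, hMM', ha, rfl⟩
  exact sandwich_mem_motivatedClasses_of_mem_algebraicClasses hX hη hx a c M M' hc hMM' ha

/-! ## §3 Cor. 2 of André's Prop. 2.2, granted the `*_η`-stability of `A_mot(X)_ℂ` -/

/-- **Cor. 2 of Prop. 2.2 on the real carriers, GRANTED Prop. 2.2**: if `A_mot(X)_ℂ` is stable under the
Lefschetz involution `*_η` of the polarisation class `η` (André 1996 Prop. 2.2 Cor. 1: «L'ensemble `A_mot(X)_E` est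
stable sous `*`»; NOT proved in the tree — hypothesis `hstar`), then the Lefschetz components `Lᵃ' ξ_{(2q,k)}(x)` of
every MOTIVATED class `x ∈ A_motᵇ(X)_ℂ` are motivated («on a la décomposition de Lefschetz
`A_mot^j(X)_E = ⊕ Lᵏ P_mot^{j-2k}(X)_E`», Cor. 2): the sandwiches `Lᵃ *_η Lᶜ x` are then motivated.
[cite: Andre1996Motifs, Prop. 2.2 Cor. 1–2 (p. 16)] -/
theorem lefschetzPowTo_primitivePart_mem_motivatedClasses_of_star (hX : IsSmoothProjective n X)
    (hη : IsPolarizationClass n X η)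
    (hstar : ∀ ⦃e e' : ℕ⦄ (hee' : 2 * e + 2 * e' = 2 * n), ∀ y ∈ motivatedClasses n X e,
      lefschetzInvolution hη.hasHardLefschetz hee' y ∈ motivatedClasses n X e')
    {b : ℕ} {x : complexBetti X (2 * b)} (hx : x ∈ motivatedClasses n X b)
    (q k : ℕ) (hqk : 2 * q + 2 * k = 2 * b) (a' : ℕ) {r : ℕ} (hr : 2 * q + 2 * a' = 2 * r) :
    lefschetzPowTo η a' (2 * q) (2 * r) hr
        (primitivePart η n hη.hasHardLefschetz (fun _ hm ↦ subsingleton_complexBetti hX hm) ⟨(2 * q, k), hqk⟩ x) ∈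
      motivatedClasses n X r := by
  classical
  have hvan : ∀ m, 2 * n < m → Subsingleton (complexBetti X m) := fun m hm ↦ subsingleton_complexBetti hX hm
  by_cases hlive : n < 2 * q + k
  · rw [primitivePart_of_lt hη.hasHardLefschetz hvan ⟨(2 * q, k), hqk⟩ hlive, LinearMap.zero_apply, map_zero]
    exact Submodule.zero_mem _
  have hmem : (⟨(2 * q, k), hqk⟩ : {ik : ℕ × ℕ // ik.1 + 2 * ik.2 = 2 * b}) ∈
      Finset.univ.filter (fun ik : {ik : ℕ × ℕ // ik.1 + 2 * ik.2 = 2 * b} ↦ ik.1.1 + ik.1.2 ≤ n) :=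
    Finset.mem_filter.2 ⟨Finset.mem_univ _, by simpa using not_lt.1 hlive⟩
  have hdec : x = ∑ ik ∈ Finset.univ.filter (fun ik : {ik : ℕ × ℕ // ik.1 + 2 * ik.2 = 2 * b} ↦ ik.1.1 + ik.1.2 ≤ n),
      lefschetzPowTo η ik.1.2 ik.1.1 (2 * b) ik.2 (primitivePart η n hη.hasHardLefschetz hvan ik x) := by
    rw [Finset.sum_filter]
    conv_lhs => rw [← sum_lefschetzPowTo_primitivePart hη.hasHardLefschetz hvan x]
    refine Finset.sum_congr rfl fun ik _ ↦ ?_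
    split_ifs with h
    · rfl
    · rw [primitivePart_of_lt hη.hasHardLefschetz hvan ik (not_le.1 h), LinearMap.zero_apply, map_zero]
  have hspan := lefschetzComponent_mem_sandwichSpan hη.hasHardLefschetz _ _
    (fun ik ↦ primitivePart_mem hη.hasHardLefschetz hvan ik x) (fun ik hik ↦ (Finset.mem_filter.1 hik).2) hdec
    hmem a' hr
  refine (Submodule.span_le.2 ?_) hspan
  rintro z ⟨a, c, M, M', hc, hMM', ha, rfl⟩
  obtain rfl : M = 2 * (b + c) := by omega
  obtain ⟨e, he⟩ : ∃ e, b + c + e = n := ⟨n - (b + c), by omega⟩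
  obtain rfl : M' = 2 * e := by omega
  obtain rfl : r = e + a := by omega
  have h1 := Ring2.Hypotheses.lefschetzPowTo_mem_motivatedClasses_of_mem hX hη.mem_algebraicClasses c b hc hx
  have h2 := hstar hMM' _ h1
  exact Ring2.Hypotheses.lefschetzPowTo_mem_motivatedClasses_of_mem hX hη.mem_algebraicClasses a e ha h2

end Summit.HodgeConjecture.HodgeConjecture.Theorems

end
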